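/-
COR-CM (cell pub-hodgecm2, stage 2 of the Hodge ladder) — junction B01, leaf B01-O: the joint theta-pinned end displays of the x1 lane
(`CorCM/B01/FaceWedgeMeet*.lean`, lead NAMING RULING HOME/INBOX l.4194 (3)) with the universal LEVEL-MEETING binder `hLM` for the
model's Matsushima embedding `Model.embOf` DISCHARGED BY NAME by item (iii) D3 `Model.embOf_levelMeet`
(`Transposition/Item3LevelMeetHolds.lean`, tr-prover-3).  Sequel of `CorCM/B01/FaceWedgeMeetJointLevelMeet.lean` (p296136).  After this
file the clause-per-lane display carries ONE hypothesis — the per-face datum — and NO item-(iii) binder at all: (γ) `inner_emb` =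
`Model.embOf_inner_emb` (D2, p290113), (β) `emb_cover` never occurs (re-typed to level-MEETING, COORDINATOR ASK 2026-08-21T18:15:15Z (i),
tgtbt-1 ruling STRONGER-THAN-CONSUMED),
level-meeting = `Model.embOf_levelMeet` (D3) — i.e. the re-typed clause `hLM` is not only consistent but PROVED at `Model.embOf`.
CAVEAT OF RECORD (b01-idea-1 IDEA-1v §3, HOME/INBOX l.4777; PKG `HodgeCM/Model/EndStateMeet.lean` ll. 18–29, hazard C6): clause (3) of the
per-face datum below is the CLOSURE-SPAN (generator) form of `Real34` relative to the PIECE-SUPPORTED embedding `Model.embOf`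
(`Transposition/Item3EmbOf.lean`:375); for the GENUINE theta setting it fails as soon as the class set of the torus is non-trivial, so the
datum is inhabitable at `U_rec` only through non-genuine settings (it stays PerLFace-strength: idea-2 IDEA-2u, b28 §X7) and is NOT the
port socket — that is the MEETING form `Model.hc_cm_of_jointThetaPin_meeting_rec` (`FaceWedgeMeetJointMeeting.lean`:172, p292271) and its
LIFT variant `Model.hc_cm_of_jointThetaPin_lift_rec` (`FaceWedgeMeetJointLift.lean`).  What this file certifies is the DISCHARGE of
`hLM`.  AUTHORED AND FILED by seat prover-pub-hodgecm2-b01-x1-g3-0 (b01-x1 gen 3), 2026-08-21.  Theorems only: no `def`, no instance, no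
cite binder, nothing cited as a record, nothing asserted, no `sorry`; `Interfaces.lean` (C1), the E term, `Transposition/*` and the other
`CorCM/B01/*` files untouched.
T5 (standing tribunal item, COORDINATOR RULING 2026-08-21T15:33:56Z (3)): single-hypothesis displays; the per-face binder set is the
T5-checked set of p296136 (f8be760e179d, 17:53:18Z) minus `hLM`; line requested on the exact bytes before filing all the same
(HOME/INBOX; HOME/T5-LEDGER.md).
FRAMING (COORDINATOR RULING 2026-08-21T11:55:35Z): `HC_CM` is NOT proved; B01-O is NOT proved; the per-face binder below is OPEN in the
tree at a general face and inhabited by no one.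
-/
import Summits.HodgeConjecture.CorCM.B01.FaceWedgeMeetJointLevelMeet
import Summits.HodgeConjecture.CorCM.B01.Transposition.Item3LevelMeetHolds
import HarnessLib

/-!
# B01-O, joint theta-pinned displays with level-meeting for `embOf` discharged (item (iii) binder-free)

`Model.hc_cm_of_jointThetaPin_levelMeet[_rec]` (p296136) take, besides the per-face datum `h`, ONE universal binder `hLM` —
level-meeting for `Model.embOf` on `F²H²`-classes of the tower of every hermitian 3-space over every CM field `L` with `2 < [L:ℚ]`.  Item
(iii) D3 proves exactly that statement: `Model.embOf_levelMeet (hHD hI hU h₃) (hL : 2 < [L:ℚ]) (V) (Γ₁ Γ₂) (x y) (hx hy) (h)`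
(`Transposition/Item3LevelMeetHolds.lean`; two-piece
meeting lemma on `[U(V)]`, a rational isometry `γ`, the level `Level.meetConj`, the level covering and the Hecke translation as the two
MORPHISMS).  Plugging it in (`hU := ballQuotientUniformisedDatum_of h₁`; `picardCMUniverse = universeOf` definitionally):

* `Model.exists_periodNV_free_of_jointThetaPin_generators (hHD hI h₁ h₃) (h)` — free face-period witnesses from the per-face datum of
  p296136 ALONE (S, Siso, translate-closure, C5′ at the pinned sets, generator-form `Real34`);
* `Model.hc_cm_of_jointThetaPin_generators (hHD hI h₁ h₃) (hR) (h) : HC_CM` and `Model.hc_cm_of_jointThetaPin_generators_rec (h) : HC_CM`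
  (universe OF RECORD, ONE hypothesis);

Per-face binders left (∃ `ι₁ V σ`): DATA `S : Transposition.FaceThetaSupply` [S2] · DATA `Siso : Perl34.IsolationSetting H (Lp ℂ 2 V.autMeasure) …`
[(v-S)] · (1) translate-closure along the honest Hecke family [(vi-3)] · (2′) C5′ `gen12Meet` at the pinned theta sets [(v-g′)] ·
(3) generator (closure-span) form of `Real34` [(v-r); HAZARD class at `embOf`, see the caveat above].  NOT binders: item (iii) (D1 `embOf`
p289518, D2 p290113, D3), B01-H (p277416), Prop 3.6/Thm 3.7 (p277743, inside `IsolationSpans.periodNV_ofSetting_meet` p280226), HR (2,0),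
the universe facts, Hom-fullness on `U_rec`.
STRENGTH: unchanged — every per-face display on this path is PeriodNV-strength with `Siso` un-pinned (idea-2 IDEA-2u, b28 §X7).
-/

noncomputable section

open scoped TensorProduct InnerProductSpace

namespace Summit.HodgeConjecture.CorCM

open MeasureTheory
open Literature.AlgebraicGeometry.Motives (CMType HodgeStructure)
open Literature.AlgebraicGeometry.Motives.HodgeStructure (conj)
open Literature.AlgebraicGeometry.HodgeTheory
open Literature.NumberTheory.Automorphic
open Literature.NumberTheory.Automorphic.PicardCM
open Prior.Perl34File (Perl34.IsolationSetting)
open Prior.Perl34File.Perl34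

namespace Model

open Transposition

/-- **Free face-period witnesses from the per-face joint theta-pinned datum of p296136 alone** (S, Siso, translate-closure, C5′ at the
pinned theta sets, generator-form `Real34`, all read through `Model.embOf`): the level-meeting binder `hLM` of
`exists_periodNV_free_of_jointThetaPin_levelMeet` is `Model.embOf_levelMeet` (item (iii) D3). [folklore] -/
theorem exists_periodNV_free_of_jointThetaPin_generators (hHD : exists_isReal_hodgeModel)
    (hI : hodgePQ_independent_of_hodgeModel) (h₁ : BallQuotientUniformised) (h₃ : CMAbelianVarietyRealised)
    (h : ∀ (F : CMField), IsGalois ℚ F → 6 ≤ Module.finrank ℚ F → ∀ f : Face F,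
      ∃ (ι₁ : F →+* ℂ) (V : HermSpace3 F ι₁) (σ : F →+* ℂ)
        (S : FaceThetaSupply (picardCMUniverse hHD hI h₁ h₃) ι₁ V F f.psi σ)
        (H CG G SK SigIdx SigIdxG : Type)
        (_ : NormedAddCommGroup H) (_ : InnerProductSpace ℂ H) (_ : CompleteSpace H)
        (_ : NormedAddCommGroup CG) (_ : NormedSpace ℂ CG) (_ : Group G) (_ : TopologicalSpace G) (_ : TopologicalSpace SK)
        (Siso : Perl34.IsolationSetting H (Lp ℂ 2 V.autMeasure) CG G SK SigIdx SigIdxG),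
        S.TranslateClosed (Transposition.Model.heckeFamily hHD hI h₁ h₃) ∧
        (∀ (Γ : Level V) (ω₁ ω₂ : (picardCMUniverse hHD hI h₁ h₃).CohC ((picardCMUniverse hHD hI h₁ h₃).pms F ι₁ V Γ) 1),
          ω₁ ∈ S.Theta 0 Γ → ω₂ ∈ S.Theta 1 Γ →
          embOf hHD hI (ballQuotientUniformisedDatum_of h₁) h₃ Γ
              ((picardCMUniverse hHD hI h₁ h₃).cup2C ((picardCMUniverse hHD hI h₁ h₃).pms F ι₁ V Γ) 1 ω₁ ω₂) ≠ 0 →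
            ∃ u ∈ Siso.t12.S12,
              ⟪embOf hHD hI (ballQuotientUniformisedDatum_of h₁) h₃ Γ
                  ((picardCMUniverse hHD hI h₁ h₃).cup2C ((picardCMUniverse hHD hI h₁ h₃).pms F ι₁ V Γ) 1 ω₁ ω₂), u⟫_ℂ ≠ 0) ∧
        (∀ χ : Siso.t34.X, Siso.t34.allowed χ → ∀ Φ : SK,
          Siso.t34.ϑ χ Φ ∈ (Submodule.span ℂ
            (thetaWedgeFns (picardCMUniverse hHD hI h₁ h₃) (embOf hHD hI (ballQuotientUniformisedDatum_of h₁) h₃)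
              S.Theta 2 3)).topologicalClosure)) :
    ∀ (F : CMField), IsGalois ℚ F → 6 ≤ Module.finrank ℚ F → ∀ f : Face F,
      ∃ (ι₁ : F →+* ℂ) (V : HermSpace3 F ι₁) (σ : F →+* ℂ), (picardCMUniverse hHD hI h₁ h₃).PeriodNV ι₁ V F f.psi σ :=
  exists_periodNV_free_of_jointThetaPin_levelMeet hHD hI h₁ h₃
    (fun {_} hL {_} V Γ₁ Γ₂ x y hx hy hne =>
      embOf_levelMeet hHD hI (ballQuotientUniformisedDatum_of h₁) h₃ hL V Γ₁ Γ₂ x y hx hy hne) h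

/-- **The clause-per-lane joint display, item (iii) binder-free**: per face, DATA `S` [S2] and `Siso` [(v-S)] with (1) translate-closure,
(2′) C5′ at the pinned theta sets [(v-g′)] and (3) generator-form `Real34` [(v-r)]; `hR` = Hom-fullness (a tree theorem on the universe
of record); level-meeting for `embOf` is `Model.embOf_levelMeet` (D3).  `HC_CM` is NOT proved. [folklore] -/
theorem hc_cm_of_jointThetaPin_generators (hHD : exists_isReal_hodgeModel) (hI : hodgePQ_independent_of_hodgeModel)
    (h₁ : BallQuotientUniformised) (h₃ : CMAbelianVarietyRealised) (hR : DeligneMilne1982_Thm_6_20_full)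
    (h : ∀ (F : CMField), IsGalois ℚ F → 6 ≤ Module.finrank ℚ F → ∀ f : Face F,
      ∃ (ι₁ : F →+* ℂ) (V : HermSpace3 F ι₁) (σ : F →+* ℂ)
        (S : FaceThetaSupply (picardCMUniverse hHD hI h₁ h₃) ι₁ V F f.psi σ)
        (H CG G SK SigIdx SigIdxG : Type)
        (_ : NormedAddCommGroup H) (_ : InnerProductSpace ℂ H) (_ : CompleteSpace H)
        (_ : NormedAddCommGroup CG) (_ : NormedSpace ℂ CG) (_ : Group G) (_ : TopologicalSpace G) (_ : TopologicalSpace SK)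
        (Siso : Perl34.IsolationSetting H (Lp ℂ 2 V.autMeasure) CG G SK SigIdx SigIdxG),
        S.TranslateClosed (Transposition.Model.heckeFamily hHD hI h₁ h₃) ∧
        (∀ (Γ : Level V) (ω₁ ω₂ : (picardCMUniverse hHD hI h₁ h₃).CohC ((picardCMUniverse hHD hI h₁ h₃).pms F ι₁ V Γ) 1),
          ω₁ ∈ S.Theta 0 Γ → ω₂ ∈ S.Theta 1 Γ →
          embOf hHD hI (ballQuotientUniformisedDatum_of h₁) h₃ Γ
              ((picardCMUniverse hHD hI h₁ h₃).cup2C ((picardCMUniverse hHD hI h₁ h₃).pms F ι₁ V Γ) 1 ω₁ ω₂) ≠ 0 →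
            ∃ u ∈ Siso.t12.S12,
              ⟪embOf hHD hI (ballQuotientUniformisedDatum_of h₁) h₃ Γ
                  ((picardCMUniverse hHD hI h₁ h₃).cup2C ((picardCMUniverse hHD hI h₁ h₃).pms F ι₁ V Γ) 1 ω₁ ω₂), u⟫_ℂ ≠ 0) ∧
        (∀ χ : Siso.t34.X, Siso.t34.allowed χ → ∀ Φ : SK,
          Siso.t34.ϑ χ Φ ∈ (Submodule.span ℂ
            (thetaWedgeFns (picardCMUniverse hHD hI h₁ h₃) (embOf hHD hI (ballQuotientUniformisedDatum_of h₁) h₃)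
              S.Theta 2 3)).topologicalClosure)) :
    HC_CM :=
  hc_cm_of_exists_facePeriod_free hHD hI h₁ h₃ (exists_periodNV_free_of_jointThetaPin_generators hHD hI h₁ h₃ h) hR

/-- **The clause-per-lane joint display on the universe OF RECORD, ONE hypothesis** (the four `_holds` data and
`deligneMilne1982_Thm_6_20_full_holds` plugged in; level-meeting for `embOf` discharged by D3; `let U := U_rec`, `let hU := …` for
legibility).  `HC_CM` is NOT proved: the hypothesis is open at a general face. [folklore] -/
theorem hc_cm_of_jointThetaPin_generators_rec :
    let U := picardCMUniverse exists_isReal_hodgeModel_holds hodgePQ_independent_of_hodgeModel_holds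
      BallQuotient.ballQuotientUniformised_holds cmAbelianVarietyRealised_holds
    let hU := ballQuotientUniformisedDatum_of BallQuotient.ballQuotientUniformised_holds
    (∀ (F : CMField), IsGalois ℚ F → 6 ≤ Module.finrank ℚ F → ∀ f : Face F,
      ∃ (ι₁ : F →+* ℂ) (V : HermSpace3 F ι₁) (σ : F →+* ℂ)
        (S : FaceThetaSupply U ι₁ V F f.psi σ)
        (H CG G SK SigIdx SigIdxG : Type)
        (_ : NormedAddCommGroup H) (_ : InnerProductSpace ℂ H) (_ : CompleteSpace H)
        (_ : NormedAddCommGroup CG) (_ : NormedSpace ℂ CG) (_ : Group G) (_ : TopologicalSpace G) (_ : TopologicalSpace SK)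
        (Siso : Perl34.IsolationSetting H (Lp ℂ 2 V.autMeasure) CG G SK SigIdx SigIdxG),
        S.TranslateClosed (Transposition.Model.heckeFamily exists_isReal_hodgeModel_holds hodgePQ_independent_of_hodgeModel_holds
          BallQuotient.ballQuotientUniformised_holds cmAbelianVarietyRealised_holds) ∧
        (∀ (Γ : Level V) (ω₁ ω₂ : U.CohC (U.pms F ι₁ V Γ) 1), ω₁ ∈ S.Theta 0 Γ → ω₂ ∈ S.Theta 1 Γ →
          embOf exists_isReal_hodgeModel_holds hodgePQ_independent_of_hodgeModel_holds hU cmAbelianVarietyRealised_holds Γ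
              (U.cup2C (U.pms F ι₁ V Γ) 1 ω₁ ω₂) ≠ 0 →
            ∃ u ∈ Siso.t12.S12,
              ⟪embOf exists_isReal_hodgeModel_holds hodgePQ_independent_of_hodgeModel_holds hU cmAbelianVarietyRealised_holds Γ
                  (U.cup2C (U.pms F ι₁ V Γ) 1 ω₁ ω₂), u⟫_ℂ ≠ 0) ∧
        (∀ χ : Siso.t34.X, Siso.t34.allowed χ → ∀ Φ : SK,
          Siso.t34.ϑ χ Φ ∈ (Submodule.span ℂ (thetaWedgeFns U
            (embOf exists_isReal_hodgeModel_holds hodgePQ_independent_of_hodgeModel_holds hU cmAbelianVarietyRealised_holds)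
              S.Theta 2 3)).topologicalClosure)) →
    HC_CM :=
  fun h ↦ hc_cm_of_jointThetaPin_generators _ _ _ _ deligneMilne1982_Thm_6_20_full_holds h

#print axioms hc_cm_of_jointThetaPin_generators_rec

end Model

end Summit.HodgeConjecture.CorCM

end
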